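import Summits.RiemannHypothesis.RiemannHypothesis.Theses.RuelleBand
import Literature.NumberTheory.LFunctions.WeilMellinBounds
import HarnessLib.Audit

/-! # Line `SketchIdeator1` (even Weil sector), stub 4: an even real test function with ĝ(ρ) ≠ 0

For every `ρ : ℂ` there is a smooth compactly supported `g : ℝ → ℂ` which is even, real-valued and
has `ĝ(ρ) = weilMellin g ρ ≠ 0`.  The construction is the one of the tree's
`Literature.NumberTheory.LFunctions.exists_isWeilTest_re_weilMellin_pos` (which does not expose
evenness / realness): `g = b`, a narrow non-negative `ContDiffBump` at `0` of outer radius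
`δ = 1/(1+|γ|)` with `γ = Im ρ`; on the support `|t| < δ` one has `cos(γ t) ≥ 0`, hence
`Re ĝ(σ+iγ) = ∫ b(t) e^{(σ-1/2)t} cos(γ t) dt > 0` for every real `σ`, in particular at `σ = Re ρ`.
Evenness is Mathlib's `ContDiffBump.neg`, realness is `Complex.ofReal_im`.
-/

noncomputable section
open Complex MeasureTheory Filter Set
open scoped Real Topology ComplexConjugate
namespace Summit.RiemannHypothesis.RiemannHypothesis.Theorems.RuelleBandExactFirstBand
open Literature.NumberTheory.LFunctions

/-- For every ordinate `γ` there is an **even, real-valued** test function `g` (a narrow non-negative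
bump at `0`) with `Re ĝ(σ + iγ) > 0` for every real `σ`: on the support `|t| < 1/(1 + |γ|)` one has
`cos(γ t) ≥ 0`, with positivity at `t = 0`.  (The tree's `exists_isWeilTest_re_weilMellin_pos` with the
two symmetry conjuncts recorded.) -/
theorem exists_even_real_isWeilTest_re_weilMellin_pos (γ : ℝ) :
    ∃ g : ℝ → ℂ, IsWeilTest g ∧ (∀ t : ℝ, g (-t) = g t) ∧ (∀ t : ℝ, (g t).im = 0) ∧
      ∀ σ : ℝ, 0 < (weilMellin g (σ + γ * I)).re := by
  -- adapted from Literature/NumberTheory/LFunctions/WeilMellinBounds.lean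
  -- (`exists_isWeilTest_re_weilMellin_pos`)
  set δ : ℝ := 1 / (1 + |γ|) with hδ
  have hδpos : 0 < δ := by positivity
  let b : ContDiffBump (0 : ℝ) := ⟨δ / 2, δ, by positivity, by linarith⟩
  refine ⟨fun t ↦ ((b t : ℝ) : ℂ), ⟨?_, ?_⟩, fun t ↦ ?_, fun t ↦ ?_, fun σ ↦ ?_⟩
  · exact Complex.ofRealCLM.contDiff.comp b.contDiff
  · exact b.hasCompactSupport.comp_left Complex.ofReal_zero
  · simp only [b.neg]
  · exact Complex.ofReal_im _
  · -- the integrand has real part `b(t) e^{(σ-1/2)t} cos(γ t) ≥ 0`, positive at `t = 0`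
    set F : ℝ → ℝ := fun t ↦ b t * Real.exp ((σ - 1 / 2) * t) * Real.cos (γ * t) with hF
    have hint : Integrable fun t : ℝ ↦ ((b t : ℝ) : ℂ) * cexp ((σ + γ * I - 1 / 2) * t) :=
      integrable_weilIntegrand (Complex.continuous_ofReal.comp b.continuous)
        (b.hasCompactSupport.comp_left Complex.ofReal_zero) _
    have hre : ∀ t : ℝ, (((b t : ℝ) : ℂ) * cexp ((σ + γ * I - 1 / 2) * t)).re = F t := by
      intro t
      rw [Complex.re_ofReal_mul, Complex.exp_re]
      have h1 : ((σ + γ * I - 1 / 2) * (t : ℂ)).re = (σ - 1 / 2) * t := by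
        simp [sub_re, add_re, mul_re]
      have h2 : ((σ + γ * I - 1 / 2) * (t : ℂ)).im = γ * t := by
        simp [sub_im, add_im, mul_im]
      rw [h1, h2, hF]
      ring
    unfold weilMellin
    have hI := integral_re hint
    simp only [RCLike.re_to_complex] at hI
    beta_reduce
    rw [← hI]
    simp_rw [hre]
    have hFc : Continuous F := by
      simp only [hF]
      have hb := b.continuous
      fun_prop
    have hFsupp : HasCompactSupport F := by
      simp only [hF]
      exact (b.hasCompactSupport.mul_right).mul_right
    have hFnn : 0 ≤ F := by
      intro t
      simp only [hF, Pi.zero_apply]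
      by_cases ht : |t| < δ
      · refine mul_nonneg (mul_nonneg (b.nonneg' t) (Real.exp_pos _).le)
          (Real.cos_nonneg_of_mem_Icc ?_)
        have hγt : |γ * t| ≤ 1 := by
          rw [abs_mul]
          calc |γ| * |t| ≤ |γ| * δ := mul_le_mul_of_nonneg_left ht.le (abs_nonneg _)
            _ = |γ| / (1 + |γ|) := by rw [hδ]; ring
            _ ≤ 1 := by rw [div_le_one (by positivity)]; linarith
        constructor <;> nlinarith [abs_le.1 hγt, Real.pi_gt_three]
      · have hb : b t = 0 := b.zero_of_le_dist (by simpa [Real.dist_eq] using not_lt.1 ht)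
        simp [hb]
    have hF0 : F 0 ≠ 0 := by
      have hb0 : b 0 = 1 := b.one_of_mem_closedBall (by simp [b]; positivity)
      simp [hF, hb0]
    exact hFc.integral_pos_of_hasCompactSupport_nonneg_nonzero hFsupp hFnn hF0

/-- **Stub 4 (S) — an even real test function seen by a given point.** For every `ρ` there is an
even, real-valued test function `g` with `ĝ(ρ) ≠ 0`: take the bump of
`exists_even_real_isWeilTest_re_weilMellin_pos (Im ρ)` and evaluate at `σ = Re ρ`, where
`Re ĝ(ρ) > 0` (`ρ = Re ρ + i Im ρ`, `Complex.re_add_im`). -/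
theorem stub_evenTestExists :
    ∀ ρ : ℂ, ∃ g : ℝ → ℂ, IsWeilTest g ∧ (∀ t : ℝ, g (-t) = g t) ∧ (∀ t : ℝ, (g t).im = 0) ∧
      weilMellin g ρ ≠ 0 := by
  intro ρ
  obtain ⟨g, hg, heven, hreal, hpos⟩ := exists_even_real_isWeilTest_re_weilMellin_pos ρ.im
  refine ⟨g, hg, heven, hreal, fun h ↦ ?_⟩
  have h1 := hpos ρ.re
  rw [Complex.re_add_im, h, Complex.zero_re] at h1
  exact lt_irrefl 0 h1

end Summit.RiemannHypothesis.RiemannHypothesis.Theorems.RuelleBandExactFirstBand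
end
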